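import Summits.AtomisticToContinuum.BoseEinsteinCondensation.Theses.BECDispersionLadder

/-!
# AtomisticToContinuum / BoseEinsteinCondensation — route `BECDispersionLadder`, assembly

Settles the assembly item `stmt-AtomisticToContinuum-14561` of route
`route-AtomisticToContinuum-BECDispersionLadder`: the implication
`OpenSideBEC → DialUniformity → EndpointTransfer → BoundaryTransferWeak → BoseEinsteinCondensation`.

Pure logic; no analytic content lives here. `DialUniformity` is by definition the implication
(body of `OpenSideBEC`) → (body of `Target`), both bodies inlined verbatim, so `OpenSideBEC` and
`DialUniformity` give `Target` by modus ponens; the route's deciding theorem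
`closes : Target → EndpointTransfer → BoundaryTransferWeak → BoseEinsteinCondensation` then concludes
the sub-problem statement by name.
-/

namespace Summit.AtomisticToContinuum.BoseEinsteinCondensation.Theorems

/-- Settles `stmt-AtomisticToContinuum-14561` (exact signature): the assembly of route
`BECDispersionLadder`, i.e. `OpenSideBEC → DialUniformity → EndpointTransfer →
BoundaryTransferWeak → BoseEinsteinCondensation`. Proof: `DialUniformity` unfolds definitionally to
`OpenSideBEC → Target` (both bodies are inlined verbatim in the route file), so rungs 1–2 give
`Target` by modus ponens, and the route's deciding theorem `closes` turns `Target`,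
`EndpointTransfer` and `BoundaryTransferWeak` into the conjunct `_root_.BoseEinsteinCondensation`,
concluded by name. [folklore] -/
theorem becDispersionLadder_assembly_proof :
    Summit.AtomisticToContinuum.BoseEinsteinCondensation.Theses.BECDispersionLadder.Assembly := by
  unfold Theses.BECDispersionLadder.Assembly
  intro h₁ h₂ h₄ h₅
  -- `h₂ h₁ : Target` definitionally (DialUniformity = OpenSideBEC-body → Target-body)
  exact Theses.BECDispersionLadder.closes (h₂ h₁) h₄ h₅

end Summit.AtomisticToContinuum.BoseEinsteinCondensation.Theorems
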